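import Summits.ValiantsHypothesis.ValiantsHypothesis.Theorems.FifoMatchingNNDivisionHardLocalizationUPat
import Literature.Barriers.PneNP.TSPExtensionComplexityHyperplaneBound

/-!
# FifoMatching · NNDivisionHard — `PatternSplit41`: THE BUDGET SPLIT OF A SUPPORT CERTIFICATE (val-idea-41 g6)

Crux workfile for `stmt-ValiantsHypothesis-21181` (`FifoMatching.NNDivisionHard`), REFUTE lens «a `Q` with small `xc(COR + Q)`».
Kernel food about GENUS I (`UPatAt`, Theorems part 12 `…LocalizationUPat`, §B7 of `Symmetry43`): the CONVERSE of its universality.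

§B7 made the unique-disjointness pattern universal by letting the row depend on `a` AND the passenger column point depend on `b`
(«no common maximiser, no single top, no located face»).  This file shows what that freedom buys AGAINST A BUDGETED PASSENGER:

* §1 `card_filter_pos_le_of_factor` — the counting heart: a nonnegative matrix on `Finset (Fin m) × Finset (Fin m)` that factors through
  `κ` nonnegative coordinates and VANISHES on the cells `#(a ∩ b) = 1` is positive on at most `|κ| · 2^m` DISJOINT cells (its positive
  cells lie in `|κ|` rectangles, each Kaibel–Weltge-valid).  Corollary `three_pow_le_add_card_defects`: the DEFECT-TOLERANT
  Yannakakis–Kaibel–Weltge bound `3^m ≤ (r+1)·2^m + #{disjoint cells with slack 0}` for ANY set with a size-`r` EF (generalises Literature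
  `HasEFOfSize.three_pow_le`, which is the case of zero defects).
* §2 `swap_max_right/left` + `exists_split` — every pattern on `P + Q` SPLITS: `x b = y b + z b` (`y b ∈ P`, `z b ∈ Q`), the rhs as
  `d a = dP a + dQ a` with `(c a, dP a)` valid on `P`, `(c a, dQ a)` valid on `Q`; on a tight cell BOTH parts are tight — in particular
  `z b` is a COMMON MAXIMISER over `Q` of every row of the star `{a : #(a ∩ b) = 1}` (COLUMN COMPLIANCE, by the swap argument: replacing the
  `Q`-part of a tight point keeps it in `P + Q`); on a disjoint cell at least one part is strict; and if `Q` has a size-`r` EF, the cells where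
  the `P`-part is NOT strict number at most `(r+1)·2^m` (§1 applied to the `Q`-slack).
* §3 tree currency (`Fam`, `UPatAt`, `COR(K_h)`): `Compliant`, `CorPat D` (an almost-unique-disjointness system of COR-valid rows and COR
  points with at most `D` non-strict disjoint cells), ★ `uPatAt_split : UPatAt q m → HasEFOfSize (conv q) r → ∃ …, CorPat ((r+1)·2^m) … ∧
  Compliant q …`, the converse recipe `uPatAt_of_corPat : CorPat 0 … → Compliant q … → UPatAt q m`, and `corPat_three_pow_le`.
  SLOGAN: «`UPat ∘ budget ⊆ column-PCM ∘ almost-UDISJ(COR)`» — against a budgeted passenger the universality of §B7 buys at most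
  `(r+1)·2^m` disjoint cells over the passenger-common-maximiser species; the enemy clause (E-U) becomes COR-INTRINSIC: a residual member is
  a budgeted `Q` whose maximiser structure is column-INcompatible with every `(r+1)·2^m`-defective unique-disjointness system of COR.
* §3b GENUS I WITH DEFECTS: `UPatAtD q m D` (at most `D` disjoint cells non-strict; sub-boards cannot remove defects, so the notion is
  wider), ★ `uPatAtD_three_pow_le : 3^m ≤ (r+1)·2^m + D` (budget-free), the class `UPatDF s` (order `> s h`, at most a third of the
  `3^m` disjoint cells defective) and ★ `decided_uPatDF` / `uPatD_decided : Decided (UPatDF ⌊√·⌋)` — the defective genus is DECIDED with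
  the floors and exchanges of `decided_uPatF`; `uPatF_succ_le_uPatDF` (genus I one order up sits inside).
* §4 `no_pattern_of_uniqueNormal` — the LIMIT REMARK made a theorem: if every maximiser of a nonzero functional over `Q` determines the
  functional up to a positive scalar (a SMOOTH convex passenger: balls, ellipsoids), then `P + Q` carries NO pattern of order `≥ 2`, for ANY
  `P`; §4b the kernel instance `uniqueNormal_euclidBall` (Cauchy–Schwarz through `(c·c) z − (c·z) c`) and `no_pattern_euclidBall`.
  (A ball is not a polytope, so this is outside the law; it explains why pattern-immunity is an exact-incidence, non-robust property:
  polytopal approximations of a ball are decided by `Face` / (E-7), the limit body is totally immune — (E-U) has members in the closure.)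

Honest label: a STRUCTURE THEOREM for genus I under budget + its defective widening (decided) + one limit remark with a kernel
instance; no new law, no residual (polytopal, budgeted) member, not progress on `CoreLawHull` / `ExactPencilLaw`; 21181 OPEN;
VP ≠ VNP NOT proved.  `rc 0`, 0 `sorry`, axioms `propext`, `Classical.choice`, `Quot.sound`.
-/

set_option linter.dupNamespace false

namespace Summit.ValiantsHypothesis.ValiantsHypothesis.Cruxes.NNDivisionHard.PatternSplit41

open Matrix Finset
open scoped Pointwise
open Literature.Barriers.PneNP (HasEFOfSize disjPairs mem_disjPairs card_disjPairs IsKWValid)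
open Literature.Combinatorics.Optimization (corPolytopeGraph corVec)
open Summit.ValiantsHypothesis.ValiantsHypothesis.Theorems.FifoMatching.Localization (Fam UPatAt)

/-! ## §1 Counting: positive cells of a vanishing-on-`#(a∩b)=1` nonnegative factorisation, and the defect-tolerant bound -/

section Counting

variable {m : ℕ}

/-- `(disjPairs univ).card = 3 ^ m` on `Fin m`. -/
theorem card_disjPairs_univ : (disjPairs (univ : Finset (Fin m))).card = 3 ^ m := by
  rw [card_disjPairs, card_univ, Fintype.card_fin]

open Classical in
/-- ★ **the counting heart.**  A matrix `B a b = ∑ k, U a k * V b k` with `U, V ≥ 0` that vanishes on every cell with `#(a ∩ b) = 1` is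
positive on at most `|κ| · 2^m` disjoint cells: the positive cells lie in the `|κ|` rectangles `{U · k > 0} × {V · k > 0}`, each of which is
Kaibel–Weltge-valid (a cell of such a rectangle has `B > 0`, hence `#(a ∩ b) ≠ 1`), hence holds at most `2^m` disjoint pairs. -/
theorem card_filter_pos_le_of_factor {κ : Type*} [Fintype κ] (U V : Finset (Fin m) → κ → ℝ)
    (hU : ∀ a k, 0 ≤ U a k) (hV : ∀ b k, 0 ≤ V b k)
    (hone : ∀ a b : Finset (Fin m), (a ∩ b).card = 1 → ∑ k, U a k * V b k = 0) :
    ((disjPairs (univ : Finset (Fin m))).filter fun p => 0 < ∑ k, U p.1 k * V p.2 k).card ≤ Fintype.card κ * 2 ^ m := by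
  set R : κ → Finset (Finset (Fin m) × Finset (Fin m)) :=
    fun k => (disjPairs (univ : Finset (Fin m))).filter fun p => 0 < U p.1 k ∧ 0 < V p.2 k with hR
  have hvalid : ∀ k, IsKWValid (R k) := by
    intro k p hp p' hp' h1
    have hp1 := (mem_filter.1 hp).2.1
    have hp2 := (mem_filter.1 hp').2.2
    have hsum := hone p.1 p'.2 h1
    have hle : U p.1 k * V p'.2 k ≤ ∑ k', U p.1 k' * V p'.2 k' :=
      single_le_sum (f := fun k' => U p.1 k' * V p'.2 k') (fun k' _ => mul_nonneg (hU _ _) (hV _ _)) (mem_univ k)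
    have hpos : 0 < U p.1 k * V p'.2 k := mul_pos hp1 hp2
    linarith
  have hsub : ((disjPairs (univ : Finset (Fin m))).filter fun p => 0 < ∑ k, U p.1 k * V p.2 k) ⊆
      (univ : Finset κ).biUnion R := by
    intro p hp
    rw [mem_filter] at hp
    obtain ⟨k, -, hk⟩ := exists_lt_of_sum_lt (by simpa using hp.2 : ∑ _k : κ, (0 : ℝ) < ∑ k, U p.1 k * V p.2 k)
    have hUk : 0 < U p.1 k := by
      rcases (hU p.1 k).lt_or_eq with h | h
      · exact h
      · rw [← h, zero_mul] at hk; exact absurd hk (lt_irrefl 0)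
    have hVk : 0 < V p.2 k := by
      rcases (hV p.2 k).lt_or_eq with h | h
      · exact h
      · rw [← h, mul_zero] at hk; exact absurd hk (lt_irrefl 0)
    exact mem_biUnion.2 ⟨k, mem_univ k, mem_filter.2 ⟨hp.1, hUk, hVk⟩⟩
  calc ((disjPairs (univ : Finset (Fin m))).filter fun p => 0 < ∑ k, U p.1 k * V p.2 k).card
      ≤ ((univ : Finset κ).biUnion R).card := card_le_card hsub
    _ ≤ ∑ k, (R k).card := card_biUnion_le
    _ ≤ ∑ _k : κ, 2 ^ m := sum_le_sum fun k _ => by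
        have h := IsKWValid.card_le_two_pow (univ : Finset (Fin m)) (R k) (hvalid k) (filter_subset _ _)
        rwa [card_univ, Fintype.card_fin] at h
    _ = Fintype.card κ * 2 ^ m := by rw [sum_const, card_univ, smul_eq_mul]

open Classical in
/-- ★ **DEFECT-TOLERANT Yannakakis–Kaibel–Weltge.**  For ANY set `P` with a size-`r` extended formulation, rows `c a · x ≤ d a` valid on `P`
and points `v b ∈ P` (`a, b ⊆ Fin m`) whose slack VANISHES on every cell with `#(a ∩ b) = 1`:
`3^m ≤ (r+1)·2^m + #{(a,b) disjoint : slack (a,b) = 0}`.  (Literature `HasEFOfSize.three_pow_le` is the case of no such cell.) -/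
theorem three_pow_le_add_card_defects {ι : Type} [Fintype ι] {P : Set (ι → ℝ)} {r : ℕ} (hP : HasEFOfSize P r)
    (v : Finset (Fin m) → ι → ℝ) (hv : ∀ b, v b ∈ P) (c : Finset (Fin m) → ι → ℝ) (d : Finset (Fin m) → ℝ)
    (hvalid : ∀ a, ∀ x ∈ P, c a ⬝ᵥ x ≤ d a) (hone : ∀ a b, (a ∩ b).card = 1 → c a ⬝ᵥ v b = d a) :
    3 ^ m ≤ (r + 1) * 2 ^ m + ((disjPairs (univ : Finset (Fin m))).filter fun p => c p.1 ⬝ᵥ v p.2 = d p.1).card := by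
  obtain ⟨U, T, hU, hT, hfac⟩ := hP.exists_nonneg_factorization v hv c d hvalid
  have hzero : ∀ a b : Finset (Fin m), (a ∩ b).card = 1 → ∑ k, U a k * T b k = 0 := by
    intro a b h1; rw [← hfac]; linarith [hone a b h1]
  have hcount := card_filter_pos_le_of_factor U T hU hT hzero
  rw [Fintype.card_option, Fintype.card_fin] at hcount
  have hsplit : (disjPairs (univ : Finset (Fin m))).card ≤
      ((disjPairs (univ : Finset (Fin m))).filter fun p => 0 < ∑ k, U p.1 k * T p.2 k).card +
      ((disjPairs (univ : Finset (Fin m))).filter fun p => c p.1 ⬝ᵥ v p.2 = d p.1).card := by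
    rw [← card_union_of_disjoint]
    · refine card_le_card fun p hp => ?_
      rw [mem_union, mem_filter, mem_filter]
      by_cases h : c p.1 ⬝ᵥ v p.2 = d p.1
      · exact Or.inr ⟨hp, h⟩
      · refine Or.inl ⟨hp, ?_⟩
        rw [← hfac]
        have := hvalid p.1 (v p.2) (hv p.2)
        exact sub_pos.2 (lt_of_le_of_ne this h)
    · rw [disjoint_filter]
      intro p _ hpos heq
      rw [← hfac, heq, sub_self] at hpos
      exact lt_irrefl _ hpos
  rw [card_disjPairs_univ] at hsplit
  omega

end Counting

/-! ## §2 The split of a pattern on a Minkowski sum (column compliance by the swap argument) -/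

section Split

variable {ι : Type} [Fintype ι]

/-- **swap argument, passenger side**: if `y + z` (`y ∈ P`, `z ∈ Q`) is a TIGHT point of an inequality valid on `P + Q`, then `z` maximises
the row over `Q` (replace the `Q`-part: `y + z'` stays in `P + Q`). -/
theorem swap_max_right {P Q : Set (ι → ℝ)} {c y z : ι → ℝ} {d : ℝ} (hvalid : ∀ x ∈ P + Q, c ⬝ᵥ x ≤ d)
    (hy : y ∈ P) (htight : c ⬝ᵥ (y + z) = d) : ∀ z' ∈ Q, c ⬝ᵥ z' ≤ c ⬝ᵥ z := by
  intro z' hz'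
  have h := hvalid (y + z') (Set.add_mem_add hy hz')
  rw [dotProduct_add] at h htight
  linarith

/-- **swap argument, COR side**: symmetrically `y` maximises the row over `P`. -/
theorem swap_max_left {P Q : Set (ι → ℝ)} {c y z : ι → ℝ} {d : ℝ} (hvalid : ∀ x ∈ P + Q, c ⬝ᵥ x ≤ d)
    (hz : z ∈ Q) (htight : c ⬝ᵥ (y + z) = d) : ∀ y' ∈ P, c ⬝ᵥ y' ≤ c ⬝ᵥ y := by
  intro y' hy'
  have h := hvalid (y' + z) (Set.add_mem_add hy' hz)
  rw [dotProduct_add] at h htight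
  linarith

/-- the passenger value of a row: `dQ = sup_{z ∈ Q} c · z` (a real `sSup`; `Q` nonempty and the row bounded on `Q` in all uses). -/
noncomputable def supOn (Q : Set (ι → ℝ)) (c : ι → ℝ) : ℝ := sSup ((fun z => c ⬝ᵥ z) '' Q)

theorem le_supOn {Q : Set (ι → ℝ)} {c : ι → ℝ} {M : ℝ} (hbdd : ∀ z ∈ Q, c ⬝ᵥ z ≤ M) {z : ι → ℝ} (hz : z ∈ Q) :
    c ⬝ᵥ z ≤ supOn Q c :=
  le_csSup ⟨M, by rintro _ ⟨z', hz', rfl⟩; exact hbdd z' hz'⟩ ⟨z, hz, rfl⟩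

theorem supOn_le {Q : Set (ι → ℝ)} (hQ : Q.Nonempty) {c : ι → ℝ} {M : ℝ} (hbdd : ∀ z ∈ Q, c ⬝ᵥ z ≤ M) : supOn Q c ≤ M :=
  csSup_le (hQ.image _) (by rintro _ ⟨z', hz', rfl⟩; exact hbdd z' hz')

theorem supOn_eq_of_max {Q : Set (ι → ℝ)} {c z : ι → ℝ} (hz : z ∈ Q) (hmax : ∀ z' ∈ Q, c ⬝ᵥ z' ≤ c ⬝ᵥ z) :
    supOn Q c = c ⬝ᵥ z :=
  le_antisymm (supOn_le ⟨z, hz⟩ hmax) (le_supOn hmax hz)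

open Classical in
/-- ★★ **THE SPLIT.**  Rows `c a · x ≤ d a` valid on `P + Q` and points `x b ∈ P + Q` (`a, b ⊆ Fin m`) with slack `0` on `#(a ∩ b) = 1` and
slack `> 0` on disjoint pairs SPLIT: `x b = y b + z b`, `y b ∈ P`, `z b ∈ Q`, rhs `dP a + dQ a = d a` on every row with a tight cell (all
`a ≠ ∅`; in general `dP a := d a − dQ a ≥ sup_P`), `(c a, dP a)` valid on `P`, `(c a, dQ a)` valid on `Q`, BOTH PARTS TIGHT on tight cells
(so `z b` is a common maximiser over `Q` of the whole star of `b`, and `y b` one over `P`), at least one part strict on disjoint cells — and,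
if `Q` has a size-`r` extended formulation, the disjoint cells whose `P`-part is NOT strict number at most `(r+1)·2^m`. -/
theorem exists_split {m : ℕ} {P Q : Set (ι → ℝ)} {r : ℕ} (hQ : HasEFOfSize Q r)
    (c : Finset (Fin m) → ι → ℝ) (d : Finset (Fin m) → ℝ) (x : Finset (Fin m) → ι → ℝ)
    (hvalid : ∀ a, ∀ w ∈ P + Q, c a ⬝ᵥ w ≤ d a) (hx : ∀ b, x b ∈ P + Q)
    (htight : ∀ a b, (a ∩ b).card = 1 → c a ⬝ᵥ x b = d a) (hdisj : ∀ a b, Disjoint a b → c a ⬝ᵥ x b < d a) :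
    ∃ (dP dQ : Finset (Fin m) → ℝ) (y z : Finset (Fin m) → ι → ℝ),
      (∀ b, y b ∈ P) ∧ (∀ b, z b ∈ Q) ∧ (∀ b, x b = y b + z b) ∧ (∀ a, dP a + dQ a = d a) ∧
      (∀ a, ∀ w ∈ P, c a ⬝ᵥ w ≤ dP a) ∧ (∀ a, ∀ w ∈ Q, c a ⬝ᵥ w ≤ dQ a) ∧
      (∀ a b, (a ∩ b).card = 1 → c a ⬝ᵥ y b = dP a ∧ c a ⬝ᵥ z b = dQ a) ∧
      (∀ a b, (a ∩ b).card = 1 → ∀ w ∈ Q, c a ⬝ᵥ w ≤ c a ⬝ᵥ z b) ∧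
      (∀ a b, Disjoint a b → c a ⬝ᵥ y b < dP a ∨ c a ⬝ᵥ z b < dQ a) ∧
      (∀ a b, Disjoint a b → c a ⬝ᵥ y b = dP a → c a ⬝ᵥ z b < dQ a) ∧
      ((disjPairs (univ : Finset (Fin m))).filter fun p => c p.1 ⬝ᵥ y p.2 = dP p.1).card ≤ (r + 1) * 2 ^ m := by
  -- decompose the points
  have hdec : ∀ b, ∃ y z, y ∈ P ∧ z ∈ Q ∧ x b = y + z := by
    intro b
    obtain ⟨y, hy, z, hz, hyz⟩ := Set.mem_add.1 (hx b)
    exact ⟨y, z, hy, hz, hyz.symm⟩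
  choose y z hy hz hxyz using hdec
  have hPne : P.Nonempty := ⟨y ∅, hy ∅⟩
  have hQne : Q.Nonempty := ⟨z ∅, hz ∅⟩
  -- the passenger rhs `dQ a := sup_Q c a`, bounded by `d a − c a · y₀`
  have hbddQ : ∀ a, ∀ w ∈ Q, c a ⬝ᵥ w ≤ d a - c a ⬝ᵥ y ∅ := by
    intro a w hw
    have h := hvalid a (y ∅ + w) (Set.add_mem_add (hy ∅) hw)
    rw [dotProduct_add] at h
    linarith
  refine ⟨fun a => d a - supOn Q (c a), fun a => supOn Q (c a), y, z, hy, hz, hxyz, fun a => by ring, ?_, ?_, ?_, ?_, ?_, ?_, ?_⟩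
  · -- validity on `P`: `sup_Q c a ≤ d a − c a · w` for `w ∈ P`
    intro a w hw
    have : supOn Q (c a) ≤ d a - c a ⬝ᵥ w := supOn_le hQne fun w' hw' => by
      have h := hvalid a (w + w') (Set.add_mem_add hw hw')
      rw [dotProduct_add] at h
      linarith
    linarith
  · exact fun a w hw => le_supOn (hbddQ a) hw
  · intro a b h1
    have ht := htight a b h1
    rw [hxyz b, dotProduct_add] at ht
    have h1' : c a ⬝ᵥ z b ≤ supOn Q (c a) := le_supOn (hbddQ a) (hz b)
    have h2' : supOn Q (c a) ≤ d a - c a ⬝ᵥ y b := supOn_le hQne fun w' hw' => by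
      have h := hvalid a (y b + w') (Set.add_mem_add (hy b) hw')
      rw [dotProduct_add] at h
      linarith
    constructor <;> linarith
  · intro a b h1
    have ht := htight a b h1
    rw [hxyz b] at ht
    exact swap_max_right (hvalid a) (hy b) ht
  · intro a b hab
    have hs := hdisj a b hab
    rw [hxyz b, dotProduct_add] at hs
    by_contra hcon
    simp only [not_or, not_lt] at hcon
    linarith [hcon.1, hcon.2]
  · intro a b hab heq
    have hs := hdisj a b hab
    rw [hxyz b, dotProduct_add] at hs
    linarith
  · -- the defect count: cells with tight `P`-part are `Q`-positive, and the `Q`-slack factors through `r + 1` nonnegative coordinates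
    obtain ⟨U, T, hU, hT, hfac⟩ := hQ.exists_nonneg_factorization z hz c (fun a => supOn Q (c a))
      (fun a w hw => le_supOn (hbddQ a) hw)
    have hzero : ∀ a b : Finset (Fin m), (a ∩ b).card = 1 → ∑ k, U a k * T b k = 0 := by
      intro a b h1
      rw [← hfac]
      have ht := htight a b h1
      rw [hxyz b, dotProduct_add] at ht
      have h1' : c a ⬝ᵥ z b ≤ supOn Q (c a) := le_supOn (hbddQ a) (hz b)
      have h2' : supOn Q (c a) ≤ d a - c a ⬝ᵥ y b := supOn_le hQne fun w' hw' => by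
        have h := hvalid a (y b + w') (Set.add_mem_add (hy b) hw')
        rw [dotProduct_add] at h
        linarith
      linarith
    have hcount := card_filter_pos_le_of_factor U T hU hT hzero
    rw [Fintype.card_option, Fintype.card_fin] at hcount
    refine le_trans (card_le_card fun p hp => ?_) hcount
    rw [mem_filter] at hp ⊢
    refine ⟨hp.1, ?_⟩
    rw [← hfac]
    have hab : Disjoint p.1 p.2 := (mem_disjPairs.1 hp.1).2.2
    have hs := hdisj p.1 p.2 hab
    rw [hxyz p.2, dotProduct_add] at hs
    linarith [hp.2]

end Split

/-! ## §3 Tree currency: `UPatAt` against a budgeted passenger = column compliance on an almost-unique-disjointness system of COR -/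

section Currency

variable {h K m : ℕ}

/-- **column compliance**: passenger points `z b ∈ conv q`, each a COMMON MAXIMISER over `conv q` of every row of the star `{a : #(a ∩ b) = 1}`. -/
def Compliant (q : Fam h K) (c : Finset (Fin m) → (Fin h × Fin h → ℝ)) (z : Finset (Fin m) → (Fin h × Fin h → ℝ)) : Prop :=
  (∀ b, z b ∈ convexHull ℝ (Set.range q)) ∧
    ∀ a b, (a ∩ b).card = 1 → ∀ w ∈ convexHull ℝ (Set.range q), c a ⬝ᵥ w ≤ c a ⬝ᵥ z b

open Classical in
/-- **`CorPat D c δ y`**: an ALMOST-unique-disjointness system of `COR(K_h)` with at most `D` defects — rows `c a · x ≤ δ a` valid on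
`COR(K_h)`, points `y b ∈ COR(K_h)` (`a, b ⊆ Fin m`), tight whenever `#(a ∩ b) = 1`, and at most `D` DISJOINT cells that are tight too
(`D = 0`: a genuine unique-disjointness pattern of COR, impossible for `m` large by `corPat_three_pow_le`). -/
def CorPat (D : ℕ) (c : Finset (Fin m) → (Fin h × Fin h → ℝ)) (δ : Finset (Fin m) → ℝ) (y : Finset (Fin m) → (Fin h × Fin h → ℝ)) :
    Prop :=
  (∀ a, ∀ x ∈ corPolytopeGraph (⊤ : SimpleGraph (Fin h)), c a ⬝ᵥ x ≤ δ a) ∧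
    (∀ b, y b ∈ corPolytopeGraph (⊤ : SimpleGraph (Fin h))) ∧
    (∀ a b, (a ∩ b).card = 1 → c a ⬝ᵥ y b = δ a) ∧
    ((disjPairs (univ : Finset (Fin m))).filter fun p => c p.1 ⬝ᵥ y p.2 = δ p.1).card ≤ D

open Classical in
/-- ★★ **`UPat ∘ budget ⊆ column-PCM ∘ almost-UDISJ(COR)`.**  Against a passenger with a size-`r` extended formulation, every unique-disjointness
pattern of order `m` on `COR(K_h) + conv q` is: an almost-unique-disjointness system of COR with at most `(r+1)·2^m` defects, whose rows are
column-compliant with the passenger, the defects being exactly the cells the passenger pays for. -/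
theorem uPatAt_split {q : Fam h K} (hq : UPatAt q m) {r : ℕ} (hB : HasEFOfSize (convexHull ℝ (Set.range q)) r) :
    ∃ (c : Finset (Fin m) → (Fin h × Fin h → ℝ)) (δ δQ : Finset (Fin m) → ℝ) (y z : Finset (Fin m) → (Fin h × Fin h → ℝ)),
      CorPat ((r + 1) * 2 ^ m) c δ y ∧ Compliant q c z ∧
      (∀ a, ∀ w ∈ convexHull ℝ (Set.range q), c a ⬝ᵥ w ≤ δQ a) ∧ (∀ a b, (a ∩ b).card = 1 → c a ⬝ᵥ z b = δQ a) ∧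
      (∀ a b, Disjoint a b → c a ⬝ᵥ y b = δ a → c a ⬝ᵥ z b < δQ a) := by
  obtain ⟨c, d, x, hval, hx, htight, hdisj⟩ := hq
  obtain ⟨dP, dQ, y, z, hy, hz, -, -, hvP, hvQ, ht2, hcomp, -, hdef, hcard⟩ := exists_split hB c d x hval hx htight hdisj
  exact ⟨c, dP, dQ, y, z, ⟨hvP, hy, fun a b h1 => (ht2 a b h1).1, hcard⟩, ⟨hz, hcomp⟩, hvQ, fun a b h1 => (ht2 a b h1).2, hdef⟩

open Classical in
/-- ★ **the converse recipe**: a defect-free unique-disjointness system of COR whose rows are column-compliant with the passenger IS a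
`UPatAt` pattern on the sum (rows `(c a, δ a + max_{conv q} c a)`, points `y b + z b`). -/
theorem uPatAt_of_corPat {q : Fam h K} {c : Finset (Fin m) → (Fin h × Fin h → ℝ)} {δ : Finset (Fin m) → ℝ}
    {y z : Finset (Fin m) → (Fin h × Fin h → ℝ)} (hP : CorPat 0 c δ y) (hC : Compliant q c z) : UPatAt q m := by
  obtain ⟨hvP, hy, ht, hcard⟩ := hP
  obtain ⟨hz, hcomp⟩ := hC
  -- the passenger maximum of each row is attained at a generator
  have hgen : ∀ a, ∃ j, ∀ w ∈ convexHull ℝ (Set.range q), c a ⬝ᵥ w ≤ c a ⬝ᵥ q j := by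
    intro a
    obtain ⟨j, -, hj⟩ := exists_max_image (univ : Finset (Fin (K + 1))) (fun j => c a ⬝ᵥ q j) univ_nonempty
    refine ⟨j, Summit.ValiantsHypothesis.ValiantsHypothesis.Theorems.FifoMatching.XcDivision.dot_le_of_mem_convexHull _ (c a) _ ?_⟩
    rintro _ ⟨j', rfl⟩
    exact hj j' (mem_univ j')
  choose j hj using hgen
  refine ⟨c, fun a => δ a + c a ⬝ᵥ q (j a), fun b => y b + z b, ?_, ?_, ?_, ?_⟩
  · intro a w hw
    obtain ⟨u, hu, v, hv, rfl⟩ := Set.mem_add.1 hw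
    rw [dotProduct_add]
    exact add_le_add (hvP a u hu) (hj a v hv)
  · exact fun b => Set.add_mem_add (hy b) (hz b)
  · intro a b h1
    rw [dotProduct_add, ht a b h1]
    have h₁ := hj a (z b) (hz b)
    have h₂ := hcomp a b h1 (q (j a)) (subset_convexHull ℝ _ ⟨j a, rfl⟩)
    linarith
  · intro a b hab
    rw [dotProduct_add]
    have h₁ := hj a (z b) (hz b)
    have hne : c a ⬝ᵥ y b ≠ δ a := by
      intro heq
      have hmem : (a, b) ∈ (disjPairs (univ : Finset (Fin m))).filter fun p => c p.1 ⬝ᵥ y p.2 = δ p.1 :=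
        mem_filter.2 ⟨mem_disjPairs.2 ⟨subset_univ _, subset_univ _, hab⟩, heq⟩
      rw [Nat.le_zero, card_eq_zero] at hcard
      rw [hcard] at hmem
      exact notMem_empty _ hmem
    have hlt : c a ⬝ᵥ y b < δ a := lt_of_le_of_ne (hvP a (y b) (hy b)) hne
    linarith

/-- every finite family's hull has SOME extended formulation (its V-representation, Literature `hasEFOfSize_convexHull_finset`). -/
theorem hasEFOfSize_hull_range (q : Fam h K) : ∃ r, HasEFOfSize (convexHull ℝ (Set.range q)) r := by
  classical
  refine ⟨(univ.image q).card, ?_⟩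
  have hS := Literature.Barriers.PneNP.hasEFOfSize_convexHull_finset (univ.image q)
  rwa [coe_image, coe_univ, Set.image_univ] at hS

open Classical in
/-- the budget-free form of the split as an EQUIVALENCE: a pattern on the sum is exactly a pair (COR system tight on `#(a∩b)=1`, compliant
passenger points) whose two slacks never vanish together on a disjoint cell. -/
theorem uPatAt_iff {q : Fam h K} : UPatAt q m ↔
    ∃ (c : Finset (Fin m) → (Fin h × Fin h → ℝ)) (δ δQ : Finset (Fin m) → ℝ) (y z : Finset (Fin m) → (Fin h × Fin h → ℝ)),
      (∀ a, ∀ w ∈ corPolytopeGraph (⊤ : SimpleGraph (Fin h)), c a ⬝ᵥ w ≤ δ a) ∧ (∀ b, y b ∈ corPolytopeGraph (⊤ : SimpleGraph (Fin h))) ∧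
      (∀ a, ∀ w ∈ convexHull ℝ (Set.range q), c a ⬝ᵥ w ≤ δQ a) ∧ (∀ b, z b ∈ convexHull ℝ (Set.range q)) ∧
      (∀ a b, (a ∩ b).card = 1 → c a ⬝ᵥ y b = δ a ∧ c a ⬝ᵥ z b = δQ a) ∧
      (∀ a b, Disjoint a b → c a ⬝ᵥ y b < δ a ∨ c a ⬝ᵥ z b < δQ a) := by
  classical
  constructor
  · rintro ⟨c, d, x, hval, hx, htight, hdisj⟩
    obtain ⟨r, hr⟩ := hasEFOfSize_hull_range q
    obtain ⟨dP, dQ, y, z, hy, hz, -, -, hvP, hvQ, ht2, -, hor, -, -⟩ := exists_split hr c d x hval hx htight hdisj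
    exact ⟨c, dP, dQ, y, z, hvP, hy, hvQ, hz, ht2, hor⟩
  · rintro ⟨c, δ, δQ, y, z, hvP, hy, hvQ, hz, ht, hor⟩
    refine ⟨c, fun a => δ a + δQ a, fun b => y b + z b, ?_, fun b => Set.add_mem_add (hy b) (hz b), ?_, ?_⟩
    · intro a w hw
      obtain ⟨u, hu, v, hv, rfl⟩ := Set.mem_add.1 hw
      rw [dotProduct_add]
      exact add_le_add (hvP a u hu) (hvQ a v hv)
    · intro a b h1
      rw [dotProduct_add, (ht a b h1).1, (ht a b h1).2]
    · intro a b hab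
      rw [dotProduct_add]
      rcases hor a b hab with hlt | hlt
      · linarith [hvQ a (z b) (hz b)]
      · linarith [hvP a (y b) (hy b)]

open Classical in
/-- the defect-tolerant bound in tree currency: an almost-unique-disjointness system of COR with `D` defects forces
`3^m ≤ (r'+1)·2^m + D` for every size-`r'` EF of `COR(K_h)` itself (with `D = 0` and `m = h`: the Kaibel–Weltge bound for COR). -/
theorem corPat_three_pow_le {D : ℕ} {c : Finset (Fin m) → (Fin h × Fin h → ℝ)} {δ : Finset (Fin m) → ℝ}
    {y : Finset (Fin m) → (Fin h × Fin h → ℝ)} (hP : CorPat D c δ y) {r' : ℕ}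
    (hEF : HasEFOfSize (corPolytopeGraph (⊤ : SimpleGraph (Fin h))) r') : 3 ^ m ≤ (r' + 1) * 2 ^ m + D := by
  obtain ⟨hvP, hy, ht, hcard⟩ := hP
  have := three_pow_le_add_card_defects hEF y hy c δ hvP ht
  omega


/-! ### §3b Genus I WITH DEFECTS: `UPatAtD` — up to a third of the disjoint cells may fail to be strict -/

open Classical in
/-- **`UPatAtD q m D`**: as `UPatAt q m` but at most `D` DISJOINT cells are allowed to be non-strict (slack `0` instead of `> 0`).
Sub-boards do not remove defects (the `m²` cells `({i},{j})` meet every sub-board of order `≥ 2`), so this is a genuinely wider pattern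
notion; it is decided by the defect-tolerant bound all the same. -/
def UPatAtD (q : Fam h K) (m D : ℕ) : Prop :=
  ∃ (c : Finset (Fin m) → (Fin h × Fin h → ℝ)) (d : Finset (Fin m) → ℝ) (x : Finset (Fin m) → (Fin h × Fin h → ℝ)),
    (∀ a, ∀ w ∈ corPolytopeGraph (⊤ : SimpleGraph (Fin h)) + convexHull ℝ (Set.range q), c a ⬝ᵥ w ≤ d a) ∧
    (∀ b, x b ∈ corPolytopeGraph (⊤ : SimpleGraph (Fin h)) + convexHull ℝ (Set.range q)) ∧
    (∀ a b, (a ∩ b).card = 1 → c a ⬝ᵥ x b = d a) ∧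
    ((disjPairs (univ : Finset (Fin m))).filter fun p => c p.1 ⬝ᵥ x p.2 = d p.1).card ≤ D

open Classical in
/-- zero defects is the genus-I pattern. -/
theorem uPatAtD_zero_iff {q : Fam h K} : UPatAtD q m 0 ↔ UPatAt q m := by
  constructor
  · rintro ⟨c, d, x, hval, hx, ht, hcard⟩
    refine ⟨c, d, x, hval, hx, ht, fun a b hab => lt_of_le_of_ne (hval a (x b) (hx b)) fun heq => ?_⟩
    rw [Nat.le_zero, card_eq_zero] at hcard
    have hmem : (a, b) ∈ (disjPairs (univ : Finset (Fin m))).filter fun p => c p.1 ⬝ᵥ x p.2 = d p.1 :=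
      mem_filter.2 ⟨mem_disjPairs.2 ⟨subset_univ _, subset_univ _, hab⟩, heq⟩
    rw [hcard] at hmem
    exact notMem_empty _ hmem
  · rintro ⟨c, d, x, hval, hx, ht, hdisj⟩
    refine ⟨c, d, x, hval, hx, ht, le_of_eq (card_eq_zero.2 (filter_eq_empty_iff.2 fun p hp heq => ?_))⟩
    exact absurd heq (ne_of_lt (hdisj p.1 p.2 (mem_disjPairs.1 hp).2.2))

open Classical in
/-- ★ **the defective pattern bound** (budget-free): `3^m ≤ (r+1)·2^m + D`. -/
theorem uPatAtD_three_pow_le {q : Fam h K} {D : ℕ} (hq : UPatAtD q m D) {r : ℕ}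
    (hEF : HasEFOfSize (corPolytopeGraph (⊤ : SimpleGraph (Fin h)) + convexHull ℝ (Set.range q)) r) :
    3 ^ m ≤ (r + 1) * 2 ^ m + D := by
  obtain ⟨c, d, x, hval, hx, ht, hcard⟩ := hq
  have := three_pow_le_add_card_defects hEF x hx c d hval ht
  omega

/-- with at most a third of the `3^m` disjoint cells defective, the order-`(m−1)` Kaibel–Weltge inequality survives. -/
theorem uPatAtD_three_pow_pred_le {q : Fam h K} {D : ℕ} (hq : UPatAtD q m D) (hD : 3 * D ≤ 3 ^ m) (hm : 1 ≤ m) {r : ℕ}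
    (hEF : HasEFOfSize (corPolytopeGraph (⊤ : SimpleGraph (Fin h)) + convexHull ℝ (Set.range q)) r) :
    3 ^ (m - 1) ≤ (r + 1) * 2 ^ (m - 1) := by
  have h := uPatAtD_three_pow_le hq hEF
  obtain ⟨k, rfl⟩ : ∃ k, m = k + 1 := ⟨m - 1, by omega⟩
  rw [Nat.add_sub_cancel]
  rw [pow_succ, pow_succ] at h
  rw [pow_succ] at hD
  set X := 3 ^ k
  set Y := 2 ^ k
  nlinarith

/-- **`UPatDF s`**: a defective unique-disjointness pattern of order `> s h` with at most a third of its disjoint cells defective. -/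
def UPatDF (s : ℕ → ℕ) : Summit.ValiantsHypothesis.ValiantsHypothesis.Theorems.FifoMatching.Localization.PClass :=
  fun h _ q => ∃ m, s h + 1 ≤ m ∧ ∃ D, 3 * D ≤ 3 ^ m ∧ UPatAtD q m D

/-- genus I sits inside the defective genus (one order higher, zero defects). -/
theorem uPatF_succ_le_uPatDF {s : ℕ → ℕ} {q : Fam h K}
    (hq : Summit.ValiantsHypothesis.ValiantsHypothesis.Theorems.FifoMatching.Localization.UPatF (fun h => s h + 1) h K q) :
    UPatDF s h K q := by
  obtain ⟨m, hm, hP⟩ := hq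
  exact ⟨m, hm, 0, Nat.zero_le _, uPatAtD_zero_iff.2 hP⟩

/-- ★ **the defective genus is DECIDED** (same floors and exchanges as `decided_uPatF`). -/
theorem decided_uPatDF {s : ℕ → ℕ} (hgrow : ∀ h₀ : ℕ, ∃ h₁ : ℕ, ∀ h ≥ h₁, h₀ ≤ s h)
    (hex : ∀ c : ℕ, ∃ c' h₁ : ℕ, ∀ h ≥ h₁, ∀ ℓ, s h ≤ ℓ →
      Summit.ValiantsHypothesis.ValiantsHypothesis.Theorems.FifoMatching.Localization.T c h ≤
        Summit.ValiantsHypothesis.ValiantsHypothesis.Theorems.FifoMatching.Localization.T c' ℓ) :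
    Summit.ValiantsHypothesis.ValiantsHypothesis.Theorems.FifoMatching.Localization.Decided (UPatDF s) := by
  intro c
  obtain ⟨c', h₁, hh₁⟩ := hex c
  obtain ⟨m₀, hm₀⟩ := Summit.ValiantsHypothesis.ValiantsHypothesis.Theorems.FifoMatching.Localization.T_lt_of_three_pow c'
  obtain ⟨h₂, hh₂⟩ := hgrow m₀
  refine ⟨h₁ + h₂, fun h hh K q r hq hEF => ?_⟩
  obtain ⟨m, hm, D, hD, hP⟩ := hq
  have hs : s h ≤ m - 1 := by omega
  exact lt_of_le_of_lt (hh₁ h (by omega) (m - 1) hs)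
    (hm₀ (m - 1) ((hh₂ h (by omega)).trans hs) r (uPatAtD_three_pow_pred_le hP hD (by omega) hEF))

/-- `UPatD := UPatDF ⌊√·⌋` is decided (floor `⌊√h⌋`, exchange `c ↦ 2c`). -/
theorem uPatD_decided : Summit.ValiantsHypothesis.ValiantsHypothesis.Theorems.FifoMatching.Localization.Decided (UPatDF Nat.sqrt) := by
  refine decided_uPatDF ?_ ?_
  · intro h₀
    refine ⟨h₀ * h₀, fun h hh => ?_⟩
    calc h₀ = Nat.sqrt (h₀ * h₀) := (Nat.sqrt_eq h₀).symm
      _ ≤ Nat.sqrt h := Nat.sqrt_le_sqrt hh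
  · intro c
    exact ⟨2 * c, 0, fun h _ ℓ hℓ => Summit.ValiantsHypothesis.ValiantsHypothesis.Theorems.FifoMatching.Localization.T_le_T_double c hℓ⟩

end Currency

/-! ## §4 The limit remark: a smooth passenger is totally immune -/

section Smooth

variable {ι : Type} [Fintype ι]

/-- `UniqueNormal Q`: every point of `Q` that maximises a NONZERO functional `c₁` over `Q` maximises only the positive multiples of `c₁`
(the outer normal cone at every boundary point is a ray — a SMOOTH convex body: Euclidean balls, ellipsoids; never a polytope of
dimension `≥ 1`). -/
def UniqueNormal (Q : Set (ι → ℝ)) : Prop :=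
  ∀ z ∈ Q, ∀ c₁ c₂ : ι → ℝ, c₁ ≠ 0 → (∀ w ∈ Q, c₁ ⬝ᵥ w ≤ c₁ ⬝ᵥ z) → (∀ w ∈ Q, c₂ ⬝ᵥ w ≤ c₂ ⬝ᵥ z) →
    ∃ t : ℝ, 0 ≤ t ∧ c₂ = t • c₁

/-- ★ **a smooth passenger is TOTALLY IMMUNE to genus I**: if `Q` has unique normals then NO unique-disjointness pattern of order `m ≥ 2`
lives on `P + Q`, for ANY set `P` (only the rows `{i}, {j}, {i,j}` and the columns `∅, {i}, {j}, {i,j}` are used: column compliance makes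
the three rows positively parallel, and then the tight cell `({i}, {i,j})` and the disjoint cell `({i}, {j})` contradict each other). -/
theorem no_pattern_of_uniqueNormal {m : ℕ} (hm : 2 ≤ m) {P Q : Set (ι → ℝ)} (hQ : UniqueNormal Q)
    (c : Finset (Fin m) → ι → ℝ) (d : Finset (Fin m) → ℝ) (x : Finset (Fin m) → ι → ℝ)
    (hvalid : ∀ a, ∀ w ∈ P + Q, c a ⬝ᵥ w ≤ d a) (hx : ∀ b, x b ∈ P + Q)
    (htight : ∀ a b, (a ∩ b).card = 1 → c a ⬝ᵥ x b = d a) (hdisj : ∀ a b, Disjoint a b → c a ⬝ᵥ x b < d a) : False := by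
  classical
  -- decompose the points and get column compliance by the swap argument
  have hdec : ∀ b, ∃ y z, y ∈ P ∧ z ∈ Q ∧ x b = y + z := by
    intro b
    obtain ⟨y, hy, z, hz, hyz⟩ := Set.mem_add.1 (hx b)
    exact ⟨y, z, hy, hz, hyz.symm⟩
  choose y z hy hz hxyz using hdec
  have hcomp : ∀ a b, (a ∩ b).card = 1 → ∀ w ∈ Q, c a ⬝ᵥ w ≤ c a ⬝ᵥ z b := by
    intro a b h1
    have ht := htight a b h1
    rw [hxyz b] at ht
    exact swap_max_right (hvalid a) (hy b) ht
  -- every nonempty row is nonzero (tight somewhere, strict at the column `∅`)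
  have hne : ∀ a : Finset (Fin m), a.Nonempty → c a ≠ 0 := by
    intro a ha h0
    obtain ⟨i, hi⟩ := ha
    have ht := htight a {i} (by rw [inter_singleton_of_mem hi, card_singleton])
    have hs := hdisj a ∅ (disjoint_empty_right a)
    rw [h0, zero_dotProduct] at ht hs
    linarith
  -- the two indices
  set i : Fin m := ⟨0, by omega⟩ with hi
  set j : Fin m := ⟨1, by omega⟩ with hj
  have hij : i ≠ j := by simp [hi, hj, Fin.ext_iff]
  -- incidences
  have h_i_i : (({i} : Finset (Fin m)) ∩ {i}).card = 1 := by simp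
  have h_j_j : (({j} : Finset (Fin m)) ∩ {j}).card = 1 := by simp
  have h_ij_i : (({i, j} : Finset (Fin m)) ∩ {i}).card = 1 := by simp
  have h_ij_j : (({i, j} : Finset (Fin m)) ∩ {j}).card = 1 := by
    rw [inter_comm]; simp [hij.symm]
  have h_i_ij : (({i} : Finset (Fin m)) ∩ {i, j}).card = 1 := by rw [inter_comm]; exact h_ij_i
  have h_j_ij : (({j} : Finset (Fin m)) ∩ {i, j}).card = 1 := by rw [inter_comm]; exact h_ij_j
  -- the three rows are positively parallel
  obtain ⟨t, ht0, htij⟩ := hQ (z {i}) (hz {i}) (c {i}) (c {i, j}) (hne {i} (singleton_nonempty i))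
    (hcomp {i} {i} h_i_i) (hcomp {i, j} {i} h_ij_i)
  obtain ⟨t', ht0', htij'⟩ := hQ (z {j}) (hz {j}) (c {j}) (c {i, j}) (hne {j} (singleton_nonempty j))
    (hcomp {j} {j} h_j_j) (hcomp {i, j} {j} h_ij_j)
  have htpos : 0 < t := by
    rcases ht0.lt_or_eq with h | h
    · exact h
    · exfalso; apply hne {i, j} ⟨i, by simp⟩; rw [htij, ← h, zero_smul]
  have ht'pos : 0 < t' := by
    rcases ht0'.lt_or_eq with h | h
    · exact h
    · exfalso; apply hne {i, j} ⟨i, by simp⟩; rw [htij', ← h, zero_smul]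
  -- `c {j} = (t / t') • c {i}`
  have hcj : c {j} = (t / t') • c {i} := by
    have : t' • c {j} = t • c {i} := by rw [← htij', htij]
    calc c {j} = (1 / t') • (t' • c {j}) := by rw [smul_smul, one_div_mul_cancel ht'pos.ne', one_smul]
      _ = (t / t') • c {i} := by rw [this, smul_smul]; ring_nf
  -- row `{j}`: tight at columns `{j}` and `{i,j}` ⇒ `c{i} · x{j} = c{i} · x{i,j}`
  have h1 := htight {j} {j} h_j_j
  have h2 := htight {j} {i, j} h_j_ij
  rw [hcj, smul_dotProduct, smul_eq_mul] at h1 h2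
  have heq : c {i} ⬝ᵥ x {j} = c {i} ⬝ᵥ x {i, j} := by
    have := h1.trans h2.symm
    exact mul_left_cancel₀ (div_pos htpos ht'pos).ne' this
  -- row `{i}`: tight at `{i,j}`, strict at the disjoint column `{j}`
  have h3 := htight {i} {i, j} h_i_ij
  have h4 := hdisj {i} {j} (disjoint_singleton.2 hij)
  rw [heq, h3] at h4
  exact lt_irrefl _ h4


/-! ### §4b a kernel instance: the Euclidean unit ball has unique normals, hence is totally immune -/

/-- the Euclidean unit ball of `ι → ℝ` in dot-product terms. -/
def euclidBall : Set (ι → ℝ) := {z | z ⬝ᵥ z ≤ 1}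

theorem dotProduct_self_nonneg' (v : ι → ℝ) : 0 ≤ v ⬝ᵥ v := Finset.sum_nonneg fun i _ => mul_self_nonneg (v i)

/-- a maximiser of a nonzero functional over the Euclidean unit ball is the normalised functional (Cauchy–Schwarz through the vector
`(c·c) z − (c·z) c`). -/
theorem eq_smul_of_max_euclidBall {c z : ι → ℝ} (hc : c ≠ 0) (hz : z ∈ euclidBall) (hmax : ∀ w ∈ euclidBall, c ⬝ᵥ w ≤ c ⬝ᵥ z) :
    c = Real.sqrt (c ⬝ᵥ c) • z := by
  have hcc : 0 < c ⬝ᵥ c := lt_of_le_of_ne (dotProduct_self_nonneg' c) (fun h => hc (dotProduct_self_eq_zero.1 h.symm))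
  set N := Real.sqrt (c ⬝ᵥ c) with hN
  have hNpos : 0 < N := Real.sqrt_pos.2 hcc
  have hN2 : N * N = c ⬝ᵥ c := Real.mul_self_sqrt hcc.le
  -- the normalised functional is in the ball, so `c · z ≥ N`
  have hw : (1 / N) • c ∈ euclidBall := by
    show ((1 / N) • c) ⬝ᵥ ((1 / N) • c) ≤ 1
    rw [smul_dotProduct, dotProduct_smul, smul_eq_mul, smul_eq_mul, ← hN2]
    field_simp
    exact le_rfl
  have hge : N ≤ c ⬝ᵥ z := by
    have h := hmax _ hw
    rw [dotProduct_smul, smul_eq_mul, ← hN2] at h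
    have : 1 / N * (N * N) = N := by field_simp
    linarith
  -- Cauchy–Schwarz via `D := (c·c) • z − (c·z) • c`
  set D := (c ⬝ᵥ c) • z - (c ⬝ᵥ z) • c with hD
  have hDD : D ⬝ᵥ D = (c ⬝ᵥ c) * ((c ⬝ᵥ c) * (z ⬝ᵥ z) - (c ⬝ᵥ z) * (c ⬝ᵥ z)) := by
    rw [hD, sub_dotProduct, dotProduct_sub, dotProduct_sub, smul_dotProduct, smul_dotProduct, smul_dotProduct, smul_dotProduct,
      dotProduct_smul, dotProduct_smul, dotProduct_smul, dotProduct_smul, dotProduct_comm z c]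
    simp only [smul_eq_mul]
    ring
  have hDnn : 0 ≤ D ⬝ᵥ D := dotProduct_self_nonneg' D
  have hzz : z ⬝ᵥ z ≤ 1 := hz
  have hzz0 : 0 ≤ z ⬝ᵥ z := dotProduct_self_nonneg' z
  -- `c · z = N`
  have hle : c ⬝ᵥ z ≤ N := by
    by_contra hlt
    rw [not_le] at hlt
    have h1 : N * N < (c ⬝ᵥ z) * (c ⬝ᵥ z) := mul_lt_mul'' hlt hlt hNpos.le hNpos.le
    have h2 : (c ⬝ᵥ c) * (z ⬝ᵥ z) ≤ c ⬝ᵥ c := by nlinarith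
    have h3 : (c ⬝ᵥ c) * ((c ⬝ᵥ c) * (z ⬝ᵥ z) - (c ⬝ᵥ z) * (c ⬝ᵥ z)) < 0 := by
      apply mul_neg_of_pos_of_neg hcc
      linarith
    linarith
  have heq : c ⬝ᵥ z = N := le_antisymm hle hge
  -- hence `D · D ≤ 0`, `D = 0`, and `c = N • z`
  have hD0 : D = 0 := by
    have : D ⬝ᵥ D ≤ 0 := by
      rw [hDD, heq, hN2]
      have : (c ⬝ᵥ c) * ((c ⬝ᵥ c) * (z ⬝ᵥ z) - c ⬝ᵥ c) = (c ⬝ᵥ c) * (c ⬝ᵥ c) * (z ⬝ᵥ z - 1) := by ring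
      rw [this]
      exact mul_nonpos_of_nonneg_of_nonpos (mul_nonneg hcc.le hcc.le) (by linarith)
    exact dotProduct_self_eq_zero.1 (le_antisymm this hDnn)
  have hcz : (c ⬝ᵥ c) • z = N • c := by
    have := sub_eq_zero.1 (hD ▸ hD0 : (c ⬝ᵥ c) • z - (c ⬝ᵥ z) • c = 0)
    rw [this, heq]
  calc c = (1 / N) • (N • c) := by rw [smul_smul, one_div_mul_cancel hNpos.ne', one_smul]
    _ = (1 / N) • ((c ⬝ᵥ c) • z) := by rw [hcz]
    _ = N • z := by rw [smul_smul, ← hN2]; congr 1; field_simp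

/-- ★ the Euclidean unit ball has unique normals … -/
theorem uniqueNormal_euclidBall : UniqueNormal (euclidBall (ι := ι)) := by
  intro z hz c₁ c₂ hc₁ h₁ h₂
  have e₁ := eq_smul_of_max_euclidBall hc₁ hz h₁
  by_cases hc₂ : c₂ = 0
  · exact ⟨0, le_rfl, by rw [hc₂, zero_smul]⟩
  have e₂ := eq_smul_of_max_euclidBall hc₂ hz h₂
  have hN₁ : 0 < Real.sqrt (c₁ ⬝ᵥ c₁) :=
    Real.sqrt_pos.2 (lt_of_le_of_ne (dotProduct_self_nonneg' c₁) (fun h => hc₁ (dotProduct_self_eq_zero.1 h.symm)))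
  set N₁ := Real.sqrt (c₁ ⬝ᵥ c₁) with hN₁def
  set N₂ := Real.sqrt (c₂ ⬝ᵥ c₂) with hN₂def
  refine ⟨N₂ / N₁, div_nonneg (hN₂def ▸ Real.sqrt_nonneg _) hN₁.le, ?_⟩
  rw [e₂, e₁, smul_smul, div_mul_cancel₀ _ hN₁.ne']

/-- … hence `P + (Euclidean unit ball)` carries no unique-disjointness pattern of order `≥ 2`, whatever `P` is (e.g. `P = COR(K_h)`): the
round limit of the polytopal passengers is TOTALLY IMMUNE to genus I. -/
theorem no_pattern_euclidBall {m : ℕ} (hm : 2 ≤ m) (P : Set (ι → ℝ))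
    (c : Finset (Fin m) → ι → ℝ) (d : Finset (Fin m) → ℝ) (x : Finset (Fin m) → ι → ℝ)
    (hvalid : ∀ a, ∀ w ∈ P + euclidBall, c a ⬝ᵥ w ≤ d a) (hx : ∀ b, x b ∈ P + euclidBall)
    (htight : ∀ a b, (a ∩ b).card = 1 → c a ⬝ᵥ x b = d a) (hdisj : ∀ a b, Disjoint a b → c a ⬝ᵥ x b < d a) : False :=
  no_pattern_of_uniqueNormal hm uniqueNormal_euclidBall c d x hvalid hx htight hdisj

end Smooth

end Summit.ValiantsHypothesis.ValiantsHypothesis.Cruxes.NNDivisionHard.PatternSplit41
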